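import Summits.AtomisticToContinuum.FouriersLaw.Theorems.HonestZwanzigOpenChainGreenKuboGibbsCutoff
import Summits.AtomisticToContinuum.FouriersLaw.Theorems.OddSectorIrreversibilityOddDensityIsCorrectorStationarity
import Summits.AtomisticToContinuum.FouriersLaw.Theorems.OddSectorIrreversibilityResponseDensityCutoffEnergy
import Summits.AtomisticToContinuum.FouriersLaw.Theorems.BondHeatUncertaintySubdiffusiveBondHeatBathBondReductionDynkin

/-!
# `OpenChainGreenKubo` (stmt-AtomisticToContinuum-12696), ★ step 1b: the Gibbs measure against the perturbed
# generator, for bounded smooth observables (derivative-free)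

Helper file (`--supports`) for the support item `HonestZwanzig.OpenChainGreenKubo`; sequel of `…GibbsCutoff.lean`.

For the pinned anharmonic chain `P = pinnedChain ω₂ lam β γ` (`ω₂ > 0`, `lam, β, γ ≥ 0`, `N ≥ 2`), the Gibbs measure
`μ_T` at `T > 0`, bath temperatures `(T + a, T + b)` and a `C²` observable `w` that is BOUNDED with
`L_{T+a,T+b} w ∈ L¹(μ_T)` (no decay of `w` or of its derivatives is assumed — the use case is a forecast `w = P_s F`,
`F ∈ C_c^∞`):

  `∫ L_{T+a,T+b} w dμ_T = (γ/T²) · (a ∫ w (p_0² - T) dμ_T + b ∫ w (p_{N-1}² - T) dμ_T)`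

(`integral_generator_gibbsMeasure_of_bounded`). With `a = δ/2 = -b` the right side is `(δ/T²) ∫ g w dμ_T` with the
Kundu–Dhar–Narayan source `g = (γ/2)(p_0² - p_{N-1}²)` (`integral_generator_gibbsMeasure_of_bounded_bias`). Proof: insert the
energy cutoffs `χ_R`; the equilibrium part `∫ χ_R (L_{T,T} w) dμ_T = ∫ (L χ_R)(w∘Θ) dμ_T` is `O(1/R)`
(`tendsto_integral_cutoff_mul_generator`, `|L χ_R| = O((1 + p_0² + p_{N-1}²)/R)`), the bath terms are
`T⁻² ∫ w χ_R (p_b² - T) dμ_T + O(1/R)` (`tendsto_integral_mul_cutoffDerivs`), then `R → ∞`. No definitions.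
-/

noncomputable section

open MeasureTheory Filter Topology Set Function
open scoped ContDiff BigOperators

namespace Summit.AtomisticToContinuum.FouriersLaw.Theorems.OpenChainGreenKubo

open Literature.MathematicalPhysics.KineticTheory.HeatConduction
open Literature.MathematicalPhysics.KineticTheory
open Summit.AtomisticToContinuum.FouriersLaw.Theorems.OddSectorIrreversibility
open Summit.AtomisticToContinuum.FouriersLaw.Theorems.SubdiffusiveBondHeat

variable {N : ℕ}

section PinnedLimits

variable {ω₂ lam β γ : ℝ} (hω : 0 < ω₂) (hl : 0 ≤ lam) (hβ : 0 ≤ β) (hγ : 0 ≤ γ) {T : ℝ} (hT : 0 < T)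

include hω hl hβ hT in
/-- `p_i²` is integrable for the Gibbs measure of the pinned chain (`p_i² ≤ 2H ≤ 2(1+H)⁴`). [folklore] -/
theorem pinnedChain_integrable_sq_momentum (i : Fin N) :
    Integrable (fun x : PhaseSpace N => x.2 i ^ 2) ((pinnedChain ω₂ lam β γ).gibbsMeasure N T) := by
  have h4 := pinnedChain_integrable_one_add_hamiltonian_pow_four hω hl hβ γ N hT
  refine (h4.const_mul 2).mono' (by fun_prop) (Eventually.of_forall fun x => ?_)
  rw [Real.norm_eq_abs, abs_of_nonneg (sq_nonneg _)]
  have hH := pinnedChain_harmonic_le_hamiltonian (ω₂ := ω₂) hl hβ γ N x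
  have hH0 : 0 ≤ (pinnedChain ω₂ lam β γ).hamiltonian N x := pinnedChain_hamiltonian_nonneg hω.le hl hβ γ N x
  set H := (pinnedChain ω₂ lam β γ).hamiltonian N x
  have hq : 0 ≤ ∑ j, ω₂ * x.1 j ^ 2 / 2 := Finset.sum_nonneg fun j _ => by positivity
  have hp : x.2 i ^ 2 / 2 ≤ ∑ j, x.2 j ^ 2 / 2 :=
    Finset.single_le_sum (f := fun j => x.2 j ^ 2 / 2) (fun j _ => by positivity) (Finset.mem_univ _)
  have h1 : (1 : ℝ) + H ≤ (1 + H) ^ 4 := by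
    have : (1 : ℝ) ≤ 1 + H := by linarith
    calc (1 : ℝ) + H = (1 + H) ^ 1 := (pow_one _).symm
      _ ≤ (1 + H) ^ 4 := pow_le_pow_right₀ this (by norm_num)
  nlinarith

include hω hl hβ hγ hT in
/-- **The equilibrium part vanishes in the limit**: for `w ∈ C²` with `|w| ≤ B`,
`∫ χ_R (L_{T,T} w) dμ_T → 0` as `R → ∞` (`= ∫ (L χ_R)(w∘Θ) dμ_T` and `|L χ_R| = O((1 + p_0² + p_{N-1}²)/R)`).
[folklore] -/
theorem tendsto_integral_cutoff_mul_generator (hN : 0 < N) {w : PhaseSpace N → ℝ} (hw : ContDiff ℝ 2 w)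
    {B : ℝ} (hwB : ∀ x, |w x| ≤ B) :
    Tendsto (fun R : ℝ => ∫ x, smoothCutoff ((pinnedChain ω₂ lam β γ).hamiltonian N x / R) *
        (pinnedChain ω₂ lam β γ).generator N T T w x ∂((pinnedChain ω₂ lam β γ).gibbsMeasure N T))
      atTop (𝓝 0) := by
  set P := pinnedChain ω₂ lam β γ with hP
  obtain ⟨S₁, hS₁0, hS₁⟩ := exists_bound_deriv_smoothCutoff
  obtain ⟨S₂, hS₂0, hS₂⟩ := exists_bound_deriv_deriv_smoothCutoff
  have hB0 : 0 ≤ B := (abs_nonneg _).trans (hwB 0)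
  -- the dominating integrable function `B (γ (T S₂ + S₁)(p_0² + p_{N-1}²) + 2γTS₁)`
  set D : PhaseSpace N → ℝ := fun x =>
    B * (γ * (T * S₂ + S₁) * (x.2 ⟨0, hN⟩ ^ 2 + x.2 ⟨N - 1, by omega⟩ ^ 2) + 2 * γ * T * S₁) with hD
  have hDi : Integrable D (P.gibbsMeasure N T) := by
    have h0 := pinnedChain_integrable_sq_momentum (N := N) hω hl hβ (γ := γ) hT ⟨0, hN⟩
    have h1 := pinnedChain_integrable_sq_momentum (N := N) hω hl hβ (γ := γ) hT ⟨N - 1, by omega⟩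
    haveI := pinnedChain_isProbabilityMeasure_gibbsMeasure hω hl hβ γ N hT
    exact (((h0.add h1).const_mul _).add (integrable_const _)).const_mul B
  refine tendsto_zero_of_abs_le_div (K := ∫ x, D x ∂(P.gibbsMeasure N T)) fun R hR => ?_
  have hR0 : 0 < R := by linarith
  rw [integral_cutoff_mul_generator_eq hω hl hβ hT.ne' R hR0 hw]
  have hbound : ∀ x, |P.generator N T T (fun y => smoothCutoff (P.hamiltonian N y / R)) x * w (x.1, -x.2)| ≤
      D x / R := by
    intro x
    rw [abs_mul]
    have hg := pinnedChain_abs_generator_cutoff_le (ω₂ := ω₂) (lam := lam) (β := β) (γ := γ) N hN hγ hT.le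
      hS₁ hS₂ hR x
    have hwx := hwB (x.1, -x.2)
    calc |P.generator N T T (fun y => smoothCutoff (P.hamiltonian N y / R)) x| * |w (x.1, -x.2)|
        ≤ (γ * (T * S₂ + S₁) * (x.2 ⟨0, hN⟩ ^ 2 + x.2 ⟨N - 1, by omega⟩ ^ 2) + 2 * γ * T * S₁) / R * B :=
          mul_le_mul hg hwx (abs_nonneg _) (div_nonneg (by positivity) hR0.le)
      _ = D x / R := by rw [hD]; ring
  calc |∫ x, P.generator N T T (fun y => smoothCutoff (P.hamiltonian N y / R)) x * w (x.1, -x.2)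
          ∂(P.gibbsMeasure N T)|
      ≤ ∫ x, |P.generator N T T (fun y => smoothCutoff (P.hamiltonian N y / R)) x * w (x.1, -x.2)|
          ∂(P.gibbsMeasure N T) := abs_integral_le_integral_abs
    _ ≤ ∫ x, D x / R ∂(P.gibbsMeasure N T) := by
        refine integral_mono_of_nonneg (Eventually.of_forall fun x => abs_nonneg _) (hDi.div_const R)
          (Eventually.of_forall hbound)
    _ = (∫ x, D x ∂(P.gibbsMeasure N T)) / R := integral_div R D

include hω hl hβ hT in
/-- **The cutoff-derivative terms vanish in the limit**: for `|w| ≤ B` and any momentum `p_i`,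
`∫ w (T ∂²_{p_i}χ_R - 2 p_i ∂_{p_i}χ_R) dμ_T → 0` as `R → ∞` (the bracket is `O((1 + p_i²)/R)`). [folklore] -/
theorem tendsto_integral_mul_cutoffDerivs {w : PhaseSpace N → ℝ} {B : ℝ} (hwB : ∀ x, |w x| ≤ B) (i : Fin N) :
    Tendsto (fun R : ℝ => ∫ x, w x *
        (T * partialP i (partialP i (fun y => smoothCutoff ((pinnedChain ω₂ lam β γ).hamiltonian N y / R))) x -
          2 * x.2 i * partialP i (fun y => smoothCutoff ((pinnedChain ω₂ lam β γ).hamiltonian N y / R)) x)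
        ∂((pinnedChain ω₂ lam β γ).gibbsMeasure N T)) atTop (𝓝 0) := by
  set P := pinnedChain ω₂ lam β γ with hP
  obtain ⟨S₁, hS₁0, hS₁⟩ := exists_bound_deriv_smoothCutoff
  obtain ⟨S₂, hS₂0, hS₂⟩ := exists_bound_deriv_deriv_smoothCutoff
  have hB0 : 0 ≤ B := (abs_nonneg _).trans (hwB 0)
  set D : PhaseSpace N → ℝ := fun x => B * ((T * S₂ + 2 * S₁) * x.2 i ^ 2 + T * S₁) with hD
  have hDi : Integrable D (P.gibbsMeasure N T) := by
    have h0 := pinnedChain_integrable_sq_momentum (N := N) hω hl hβ (γ := γ) hT i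
    haveI := pinnedChain_isProbabilityMeasure_gibbsMeasure hω hl hβ γ N hT
    exact ((h0.const_mul _).add (integrable_const _)).const_mul B
  refine tendsto_zero_of_abs_le_div (K := ∫ x, D x ∂(P.gibbsMeasure N T)) fun R hR => ?_
  have hR0 : 0 < R := by linarith
  -- explicit derivatives of the cutoff
  have hd1 : ∀ x, partialP i (fun y => smoothCutoff (P.hamiltonian N y / R)) x =
      deriv smoothCutoff (P.hamiltonian N x / R) / R * x.2 i := fun x => partialP_energyCutoff P N R i x
  have hd2 : ∀ x, partialP i (partialP i (fun y => smoothCutoff (P.hamiltonian N y / R))) x =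
      deriv (deriv smoothCutoff) (P.hamiltonian N x / R) / R ^ 2 * x.2 i ^ 2 +
        deriv smoothCutoff (P.hamiltonian N x / R) / R := fun x =>
    P.partialP_partialP_comp_hamiltonian (hasDerivAt_cutoffProfile R) (hasDerivAt_deriv_cutoffProfile R) N x i
  have hbound : ∀ x, |w x * (T * partialP i (partialP i (fun y => smoothCutoff (P.hamiltonian N y / R))) x -
      2 * x.2 i * partialP i (fun y => smoothCutoff (P.hamiltonian N y / R)) x)| ≤ D x / R := by
    intro x
    rw [hd1, hd2, abs_mul]
    set c' := deriv smoothCutoff (P.hamiltonian N x / R)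
    set c'' := deriv (deriv smoothCutoff) (P.hamiltonian N x / R)
    have h1 : |c'| ≤ S₁ := hS₁ _
    have h2 : |c''| ≤ S₂ := hS₂ _
    have hp : 0 ≤ x.2 i ^ 2 := sq_nonneg _
    have hR1 : 1 / R ^ 2 ≤ 1 / R := by
      rw [div_le_div_iff₀ (by positivity) hR0]; nlinarith
    have hin : |T * (c'' / R ^ 2 * x.2 i ^ 2 + c' / R) - 2 * x.2 i * (c' / R * x.2 i)| ≤
        ((T * S₂ + 2 * S₁) * x.2 i ^ 2 + T * S₁) / R := by
      have e : T * (c'' / R ^ 2 * x.2 i ^ 2 + c' / R) - 2 * x.2 i * (c' / R * x.2 i) =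
          T * x.2 i ^ 2 * (c'' * (1 / R ^ 2)) + T * (c' * (1 / R)) - 2 * x.2 i ^ 2 * (c' * (1 / R)) := by ring
      rw [e]
      have hc''R : |c'' * (1 / R ^ 2)| ≤ S₂ * (1 / R) := by
        rw [abs_mul, abs_of_nonneg (by positivity : (0 : ℝ) ≤ 1 / R ^ 2)]
        exact mul_le_mul h2 hR1 (by positivity) hS₂0
      have hc'R : |c' * (1 / R)| ≤ S₁ * (1 / R) := by
        rw [abs_mul, abs_of_nonneg (by positivity : (0 : ℝ) ≤ 1 / R)]
        exact mul_le_mul_of_nonneg_right h1 (by positivity)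
      have t1 : |T * x.2 i ^ 2 * (c'' * (1 / R ^ 2))| ≤ T * x.2 i ^ 2 * (S₂ * (1 / R)) := by
        rw [abs_mul, abs_of_nonneg (by positivity : (0 : ℝ) ≤ T * x.2 i ^ 2)]
        exact mul_le_mul_of_nonneg_left hc''R (by positivity)
      have t2 : |T * (c' * (1 / R))| ≤ T * (S₁ * (1 / R)) := by
        rw [abs_mul, abs_of_nonneg hT.le]
        exact mul_le_mul_of_nonneg_left hc'R hT.le
      have t3 : |2 * x.2 i ^ 2 * (c' * (1 / R))| ≤ 2 * x.2 i ^ 2 * (S₁ * (1 / R)) := by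
        rw [abs_mul, abs_of_nonneg (by positivity : (0 : ℝ) ≤ 2 * x.2 i ^ 2)]
        exact mul_le_mul_of_nonneg_left hc'R (by positivity)
      calc |T * x.2 i ^ 2 * (c'' * (1 / R ^ 2)) + T * (c' * (1 / R)) - 2 * x.2 i ^ 2 * (c' * (1 / R))|
          ≤ |T * x.2 i ^ 2 * (c'' * (1 / R ^ 2)) + T * (c' * (1 / R))| + |2 * x.2 i ^ 2 * (c' * (1 / R))| :=
            abs_sub _ _
        _ ≤ |T * x.2 i ^ 2 * (c'' * (1 / R ^ 2))| + |T * (c' * (1 / R))| + |2 * x.2 i ^ 2 * (c' * (1 / R))| :=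
            add_le_add_left (abs_add_le _ _) _
        _ ≤ T * x.2 i ^ 2 * (S₂ * (1 / R)) + T * (S₁ * (1 / R)) + 2 * x.2 i ^ 2 * (S₁ * (1 / R)) :=
            add_le_add (add_le_add t1 t2) t3
        _ = ((T * S₂ + 2 * S₁) * x.2 i ^ 2 + T * S₁) / R := by field_simp; ring
    calc |w x| * |T * (c'' / R ^ 2 * x.2 i ^ 2 + c' / R) - 2 * x.2 i * (c' / R * x.2 i)|
        ≤ B * (((T * S₂ + 2 * S₁) * x.2 i ^ 2 + T * S₁) / R) :=
          mul_le_mul (hwB x) hin (abs_nonneg _) hB0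
      _ = D x / R := by rw [hD]; ring
  calc |∫ x, w x * (T * partialP i (partialP i (fun y => smoothCutoff (P.hamiltonian N y / R))) x -
          2 * x.2 i * partialP i (fun y => smoothCutoff (P.hamiltonian N y / R)) x) ∂(P.gibbsMeasure N T)|
      ≤ ∫ x, |w x * (T * partialP i (partialP i (fun y => smoothCutoff (P.hamiltonian N y / R))) x -
          2 * x.2 i * partialP i (fun y => smoothCutoff (P.hamiltonian N y / R)) x)| ∂(P.gibbsMeasure N T) :=
        abs_integral_le_integral_abs
    _ ≤ ∫ x, D x / R ∂(P.gibbsMeasure N T) :=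
        integral_mono_of_nonneg (Eventually.of_forall fun x => abs_nonneg _) (hDi.div_const R)
          (Eventually.of_forall hbound)
    _ = (∫ x, D x ∂(P.gibbsMeasure N T)) / R := integral_div R D

end PinnedLimits


section Assembly

variable {ω₂ lam β γ : ℝ} (hω : 0 < ω₂) (hl : 0 ≤ lam) (hβ : 0 ≤ β) (hγ : 0 ≤ γ) {T : ℝ} (hT : 0 < T)
  (hN : 2 ≤ N)
include hω hl hβ hγ hT hN

/-- **The Gibbs measure against the perturbed generator, for bounded smooth observables.** For the pinned chain
(`ω₂ > 0`, `lam, β, γ ≥ 0`, `N ≥ 2`), `T > 0`, bath temperatures `(T + a, T + b)` and `w ∈ C²` with `|w| ≤ B` and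
`L_{T+a,T+b} w ∈ L¹(μ_T)`:
`∫ L_{T+a,T+b} w dμ_T = (γ/T²) (a ∫ w (p_0² - T) dμ_T + b ∫ w (p_{N-1}² - T) dμ_T)`.
The equilibrium generator integrates to zero against `μ_T` WITHOUT any decay of `∇w` (detailed balance moves it
onto the energy cutoff), and each extra bath term `γ a ∂²_{p_0}`, `γ b ∂²_{p_{N-1}}` is integrated by parts twice
onto the Gaussian weight. [folklore] -/
theorem integral_generator_gibbsMeasure_of_bounded (a b : ℝ) {w : PhaseSpace N → ℝ} (hw : ContDiff ℝ 2 w)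
    {B : ℝ} (hwB : ∀ x, |w x| ≤ B)
    (hLi : Integrable (fun x => (pinnedChain ω₂ lam β γ).generator N (T + a) (T + b) w x)
      ((pinnedChain ω₂ lam β γ).gibbsMeasure N T)) :
    ∫ x, (pinnedChain ω₂ lam β γ).generator N (T + a) (T + b) w x ∂((pinnedChain ω₂ lam β γ).gibbsMeasure N T) =
      γ * T⁻¹ ^ 2 * (a * ∫ x, w x * (x.2 ⟨0, by omega⟩ ^ 2 - T) ∂((pinnedChain ω₂ lam β γ).gibbsMeasure N T) +
        b * ∫ x, w x * (x.2 ⟨N - 1, by omega⟩ ^ 2 - T) ∂((pinnedChain ω₂ lam β γ).gibbsMeasure N T)) := by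
  set P := pinnedChain ω₂ lam β γ with hP
  set μ := P.gibbsMeasure N T with hμ
  haveI : IsProbabilityMeasure μ := pinnedChain_isProbabilityMeasure_gibbsMeasure hω hl hβ γ N hT
  have hN0 : 0 < N := by omega
  set i0 : Fin N := ⟨0, by omega⟩ with hi0
  set iN : Fin N := ⟨N - 1, by omega⟩ with hiN
  have hPγ : P.γ = γ := rfl
  have hU : ContDiff ℝ ∞ P.U := pinnedChain_contDiff_U ω₂ lam β γ
  have hV : ContDiff ℝ ∞ P.V := pinnedChain_contDiff_V ω₂ lam β γ
  have hHc : Continuous (P.hamiltonian N) := pinnedChain_continuous_hamiltonian ω₂ lam β γ N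
  have hw1 : ContDiff ℝ 1 (partialP i0 w) := contDiff_partialP hw (by norm_num) i0
  have hw1' : ContDiff ℝ 1 (partialP iN w) := contDiff_partialP hw (by norm_num) iN
  have hPP0c : Continuous (partialP i0 (partialP i0 w)) := continuous_partialP hw1 one_ne_zero i0
  have hPPNc : Continuous (partialP iN (partialP iN w)) := continuous_partialP hw1' one_ne_zero iN
  have hB0 : 0 ≤ B := (abs_nonneg _).trans (hwB 0)
  have hpc : ∀ i : Fin N, Continuous fun x : PhaseSpace N => x.2 i := fun i =>
    (continuous_apply i).comp continuous_snd
  -- the cutoff family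
  have hχc : ∀ {R : ℝ}, 0 < R → HasCompactSupport fun y : PhaseSpace N => smoothCutoff (P.hamiltonian N y / R) :=
    fun hR => hasCompactSupport_energyCutoff hω hl hβ γ N hR
  have hχcont : ∀ R : ℝ, Continuous fun y : PhaseSpace N => smoothCutoff (P.hamiltonian N y / R) := fun R =>
    (contDiff_smoothCutoff (n := 0)).continuous.comp (hHc.div_const R)
  -- pointwise split of the generator
  have hsplit : ∀ x, P.generator N (T + a) (T + b) w x =
      P.generator N T T w x + γ * (a * partialP i0 (partialP i0 w) x + b * partialP iN (partialP iN w) x) := by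
    intro x
    rw [generator_temp_split P N T a b w x, sum_bath_two hN a b w x, hPγ]
  -- integrable pieces with a cutoff (`R > 0`)
  have hint2 : ∀ {R : ℝ}, 0 < R → ∀ (i : Fin N), Continuous (partialP i (partialP i w)) →
      Integrable (fun x => smoothCutoff (P.hamiltonian N x / R) * partialP i (partialP i w) x) μ :=
    fun hR i hc => ((hχcont _).mul hc).integrable_of_hasCompactSupport (hχc hR).mul_right
  have hint1 : ∀ {R : ℝ}, 0 < R →
      Integrable (fun x => smoothCutoff (P.hamiltonian N x / R) * P.generator N T T w x) μ := by
    intro R hR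
    have h : (fun x => smoothCutoff (P.hamiltonian N x / R) * P.generator N T T w x) =
        fun x => smoothCutoff (P.hamiltonian N x / R) * P.generator N (T + a) (T + b) w x -
          γ * (a * (smoothCutoff (P.hamiltonian N x / R) * partialP i0 (partialP i0 w) x) +
            b * (smoothCutoff (P.hamiltonian N x / R) * partialP iN (partialP iN w) x)) := by
      funext x; rw [hsplit x]; ring
    rw [h]
    refine Integrable.sub ?_ ((((hint2 hR i0 hPP0c).const_mul a).add ((hint2 hR iN hPPNc).const_mul b)).const_mul γ)
    exact hLi.bdd_mul (c := 1) (hχcont R).aestronglyMeasurable (Eventually.of_forall fun x => by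
      rw [Real.norm_eq_abs, abs_of_nonneg (smoothCutoff_nonneg _)]; exact smoothCutoff_le_one _)
  -- the cutoff identity, for every `R > 0`
  have hF : ∀ R : ℝ, 0 < R →
      ∫ x, smoothCutoff (P.hamiltonian N x / R) * P.generator N (T + a) (T + b) w x ∂μ =
        (∫ x, smoothCutoff (P.hamiltonian N x / R) * P.generator N T T w x ∂μ) +
          γ * (a * ∫ x, smoothCutoff (P.hamiltonian N x / R) * partialP i0 (partialP i0 w) x ∂μ +
            b * ∫ x, smoothCutoff (P.hamiltonian N x / R) * partialP iN (partialP iN w) x ∂μ) := by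
    intro R hR
    have h : (fun x => smoothCutoff (P.hamiltonian N x / R) * P.generator N (T + a) (T + b) w x) =
        fun x => smoothCutoff (P.hamiltonian N x / R) * P.generator N T T w x +
          γ * (a * (smoothCutoff (P.hamiltonian N x / R) * partialP i0 (partialP i0 w) x) +
            b * (smoothCutoff (P.hamiltonian N x / R) * partialP iN (partialP iN w) x)) := by
      funext x; rw [hsplit x]; ring
    have iA : Integrable (fun x => a * (smoothCutoff (P.hamiltonian N x / R) * partialP i0 (partialP i0 w) x)) μ :=
      (hint2 hR i0 hPP0c).const_mul a
    have iB : Integrable (fun x => b * (smoothCutoff (P.hamiltonian N x / R) * partialP iN (partialP iN w) x)) μ :=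
      (hint2 hR iN hPPNc).const_mul b
    have iAB : Integrable (fun x => a * (smoothCutoff (P.hamiltonian N x / R) * partialP i0 (partialP i0 w) x) +
        b * (smoothCutoff (P.hamiltonian N x / R) * partialP iN (partialP iN w) x)) μ := iA.add iB
    have iγAB : Integrable (fun x => γ * (a * (smoothCutoff (P.hamiltonian N x / R) * partialP i0 (partialP i0 w) x) +
        b * (smoothCutoff (P.hamiltonian N x / R) * partialP iN (partialP iN w) x))) μ := iAB.const_mul γ
    rw [h, integral_add (hint1 hR) iγAB, integral_const_mul, integral_add iA iB, integral_const_mul,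
      integral_const_mul]
  -- limits of the three pieces
  have hL0 : Tendsto (fun R : ℝ => ∫ x, smoothCutoff (P.hamiltonian N x / R) * P.generator N (T + a) (T + b) w x ∂μ)
      atTop (𝓝 (∫ x, P.generator N (T + a) (T + b) w x ∂μ)) := tendsto_integral_cutoff_mul P N μ hHc hLi
  have hL1 : Tendsto (fun R : ℝ => ∫ x, smoothCutoff (P.hamiltonian N x / R) * P.generator N T T w x ∂μ)
      atTop (𝓝 0) := tendsto_integral_cutoff_mul_generator hω hl hβ hγ hT hN0 hw hwB
  have hbath : ∀ (i : Fin N), Continuous (partialP i (partialP i w)) →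
      Tendsto (fun R : ℝ => ∫ x, smoothCutoff (P.hamiltonian N x / R) * partialP i (partialP i w) x ∂μ)
        atTop (𝓝 (T⁻¹ ^ 2 * ∫ x, w x * (x.2 i ^ 2 - T) ∂μ)) := by
    intro i _
    have hwi : Integrable (fun x => w x * (x.2 i ^ 2 - T)) μ := by
      have h2 : Integrable (fun x : PhaseSpace N => x.2 i ^ 2 - T) μ :=
        (pinnedChain_integrable_sq_momentum hω hl hβ hT i).sub (integrable_const T)
      exact h2.bdd_mul (c := B) hw.continuous.aestronglyMeasurable
        (Eventually.of_forall fun x => by rw [Real.norm_eq_abs]; exact hwB x)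
    have hmain : Tendsto (fun R : ℝ => ∫ x, w x * smoothCutoff (P.hamiltonian N x / R) * (x.2 i ^ 2 - T) ∂μ)
        atTop (𝓝 (∫ x, w x * (x.2 i ^ 2 - T) ∂μ)) := by
      have h := tendsto_integral_cutoff_mul P N μ hHc hwi
      refine h.congr fun R => ?_
      exact integral_congr_ae (Eventually.of_forall fun x => by ring)
    have herr := tendsto_integral_mul_cutoffDerivs (N := N) hω hl hβ (γ := γ) hT hwB i
    have hsum := (hmain.const_mul (T⁻¹ ^ 2)).add (herr.const_mul T⁻¹)
    rw [mul_zero, add_zero] at hsum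
    refine hsum.congr' ?_
    filter_upwards [eventually_gt_atTop (0 : ℝ)] with R hR
    exact (integral_cutoff_mul_partialP_partialP_gibbsMeasure P hU hV N hT.ne' R (hχc hR) hw i).symm
  have hlim := hL1.add (((((hbath i0 hPP0c).const_mul a).add ((hbath iN hPPNc).const_mul b))).const_mul γ)
  rw [zero_add] at hlim
  have hlim' : Tendsto (fun R : ℝ => ∫ x, smoothCutoff (P.hamiltonian N x / R) * P.generator N (T + a) (T + b) w x ∂μ)
      atTop (𝓝 (γ * (a * (T⁻¹ ^ 2 * ∫ x, w x * (x.2 i0 ^ 2 - T) ∂μ) +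
        b * (T⁻¹ ^ 2 * ∫ x, w x * (x.2 iN ^ 2 - T) ∂μ)))) := by
    refine hlim.congr' ?_
    filter_upwards [eventually_gt_atTop (0 : ℝ)] with R hR
    exact (hF R hR).symm
  have heq := tendsto_nhds_unique hL0 hlim'
  rw [heq]
  ring

/-- **The KDN source.** With `a = δ/2`, `b = -δ/2`:
`∫ L_{T+δ/2,T-δ/2} w dμ_T = (δ/T²) ∫ g w dμ_T`, `g = (γ/2)(p_0² - p_{N-1}²)`, for bounded `w ∈ C²` with
`L w ∈ L¹(μ_T)`. [cite: KunduDharNarayan2009, p. 3] -/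
theorem integral_generator_gibbsMeasure_of_bounded_bias (δ : ℝ) {w : PhaseSpace N → ℝ} (hw : ContDiff ℝ 2 w)
    {B : ℝ} (hwB : ∀ x, |w x| ≤ B)
    (hLi : Integrable (fun x => (pinnedChain ω₂ lam β γ).generator N (T + δ / 2) (T - δ / 2) w x)
      ((pinnedChain ω₂ lam β γ).gibbsMeasure N T)) :
    ∫ x, (pinnedChain ω₂ lam β γ).generator N (T + δ / 2) (T - δ / 2) w x
        ∂((pinnedChain ω₂ lam β γ).gibbsMeasure N T) =
      δ / T ^ 2 * ∫ x, γ / 2 * (x.2 ⟨0, by omega⟩ ^ 2 - x.2 ⟨N - 1, by omega⟩ ^ 2) * w x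
        ∂((pinnedChain ω₂ lam β γ).gibbsMeasure N T) := by
  set P := pinnedChain ω₂ lam β γ with hP
  set μ := P.gibbsMeasure N T with hμ
  haveI : IsProbabilityMeasure μ := pinnedChain_isProbabilityMeasure_gibbsMeasure hω hl hβ γ N hT
  have hsub : T - δ / 2 = T + -(δ / 2) := by ring
  have hLi' : Integrable (fun x => P.generator N (T + δ / 2) (T + -(δ / 2)) w x) μ := by rw [← hsub]; exact hLi
  rw [hsub, integral_generator_gibbsMeasure_of_bounded hω hl hβ hγ hT hN (δ / 2) (-(δ / 2)) hw hwB hLi']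
  have hB0 : 0 ≤ B := (abs_nonneg _).trans (hwB 0)
  have hwi : ∀ i : Fin N, Integrable (fun x => w x * (x.2 i ^ 2 - T)) μ := fun i =>
    ((pinnedChain_integrable_sq_momentum hω hl hβ hT i).sub (integrable_const T)).bdd_mul (c := B)
      hw.continuous.aestronglyMeasurable (Eventually.of_forall fun x => by rw [Real.norm_eq_abs]; exact hwB x)
  have e : (fun x => γ / 2 * (x.2 ⟨0, by omega⟩ ^ 2 - x.2 ⟨N - 1, by omega⟩ ^ 2) * w x) =
      fun x => γ / 2 * (w x * (x.2 ⟨0, by omega⟩ ^ 2 - T)) - γ / 2 * (w x * (x.2 ⟨N - 1, by omega⟩ ^ 2 - T)) := by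
    funext x; ring
  rw [e, integral_sub ((hwi _).const_mul _) ((hwi _).const_mul _), integral_const_mul, integral_const_mul]
  field_simp
  ring

end Assembly

end Summit.AtomisticToContinuum.FouriersLaw.Theorems.OpenChainGreenKubo

end
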